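import Summits.NavierStokesRegularity.NavierStokesRegularity.Theorems.EfficiencyFloorNearSaturationNearMaximiserSeqCoreHeatUniform
import HarnessLib

/-!
# Route `EfficiencyFloor`, crux `NearSaturationNearMaximiser` (stmt-NavierStokesRegularity-25482) on the
# `ProductionEfficiencyDecay` ladder (stmt-22866): LOCAL RELLICH–KONDRACHOV ON `ℝ³`, UNCONDITIONAL

Def-free helper file, twenty-first of the group: the unconditional packaging of the local Rellich–Kondrachov theorem on `ℝ³` assembled
in `…SeqCoreRellichOfHeat` (sequential Banach–Alaoglu + heat mollification + dominated convergence + `3ε`), with its two heat-semigroup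
hypotheses now discharged (`uniform_mollification_bound`, `mollification_of_uniform`, `heat_L2_continuity_of_mollification`).
Reusable by every route of the summit that needs local `L²` compactness of `H¹(ℝ³)`-bounded sequences of `C¹` vector fields.

* `heat_mollification_estimate` — (HM): `∫‖g − e^{tΔ}g‖² ≤ 288·t·∫‖Dg‖²` for `C¹` fields with `g, Dg ∈ L²`;
* `heat_L2_continuity` — (HC): `∫‖e^{tΔ}G − G‖² → 0` as `t → 0⁺` for `G ∈ L²(ℝ³; ℝ³)`;
* `localRellich` — every sequence of `C¹` fields `g_k : ℝ³ → ℝ³` with `∫‖g_k‖² ≤ 1`, `∫‖Dg_k‖² ≤ 1` has a subsequence converging in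
  `L²(B(0,R))`, for every `R > 0`, to one `L²` field. [cite: Evans2010, §5.7 Thm. 1]

HONEST FRAMING: a tool; stmt-25482, `LerayFloorGap`, `ProductionEfficiencyDecay` (stmt-22866) and Navier–Stokes regularity stay OPEN;
no summit statement is proved. [folklore]
-/

-- the problem directory repeats the summit name (`NavierStokesRegularity/NavierStokesRegularity`)
set_option linter.dupNamespace false

noncomputable section

namespace Summit.NavierStokesRegularity.NavierStokesRegularity.Theorems

namespace NearSaturationNearMaximiser

namespace SeqCore

open Set MeasureTheory Filter Topology Function Real
open scoped InnerProductSpace ENNReal NNReal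
open Literature.Analysis.UnboundedOperators

/-- **Heat mollification estimate** (HM), unconditional: for `C¹` fields `g : ℝ³ → ℝ³` with `g, Dg ∈ L²` and `t > 0`,
`‖g − e^{tΔ}g‖²` is integrable and `∫‖g − e^{tΔ}g‖² ≤ 288 · t · ∫‖Dg‖²`. [folklore] -/
theorem heat_mollification_estimate :
    ∃ Cm : ℝ, ∀ g : EuclideanSpace ℝ (Fin 3) → EuclideanSpace ℝ (Fin 3), ContDiff ℝ 1 g →
      Integrable (fun x => ‖g x‖ ^ 2) → Integrable (fun x => ‖fderiv ℝ g x‖ ^ 2) → ∀ t : ℝ, 0 < t →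
        Integrable (fun x => ‖g x - heatExtension g t x‖ ^ 2) ∧
          ∫ x, ‖g x - heatExtension g t x‖ ^ 2 ≤ Cm * t * ∫ x, ‖fderiv ℝ g x‖ ^ 2 :=
  mollification_of_uniform ⟨288, fun _ hg I2 ID _ _ ha hat => uniform_mollification_bound hg I2 ID ha hat⟩

/-- **`L²`-continuity of the heat semigroup at `0⁺`** (HC), unconditional: `∫‖e^{tΔ}G − G‖² → 0` for `G ∈ L²(ℝ³; ℝ³)`. [folklore] -/
theorem heat_L2_continuity {G : EuclideanSpace ℝ (Fin 3) → EuclideanSpace ℝ (Fin 3)} (hG : MemLp G 2 volume) :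
    Tendsto (fun t : ℝ => ∫ x, ‖heatExtension G t x - G x‖ ^ 2) (𝓝[>] 0) (𝓝 0) :=
  heat_L2_continuity_of_mollification heat_mollification_estimate G hG

/-- **Local Rellich–Kondrachov on `ℝ³`** (unconditional): every sequence of `C¹` fields `g_k : ℝ³ → ℝ³` with `∫‖g_k‖² ≤ 1` and
`∫‖Dg_k‖² ≤ 1` has a subsequence converging in `L²(B(0,R))`, for every `R > 0`, to one `L²` field `Ω` (its weak limit).
[cite: Evans2010, §5.7 Thm. 1] -/
theorem localRellich (g : ℕ → EuclideanSpace ℝ (Fin 3) → EuclideanSpace ℝ (Fin 3)) (hg : ∀ k, ContDiff ℝ 1 (g k))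
    (hI2 : ∀ k, Integrable (fun x => ‖g k x‖ ^ 2)) (hID : ∀ k, Integrable (fun x => ‖fderiv ℝ (g k) x‖ ^ 2))
    (hZ : ∀ k, ∫ x, ‖g k x‖ ^ 2 ≤ 1) (hD : ∀ k, ∫ x, ‖fderiv ℝ (g k) x‖ ^ 2 ≤ 1) :
    ∃ Ω : EuclideanSpace ℝ (Fin 3) → EuclideanSpace ℝ (Fin 3), MemLp Ω 2 volume ∧ ∃ φ : ℕ → ℕ, StrictMono φ ∧
      ∀ R : ℝ, 0 < R → Tendsto (fun k => ∫ x in Metric.ball (0 : EuclideanSpace ℝ (Fin 3)) R, ‖g (φ k) x - Ω x‖ ^ 2)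
        atTop (𝓝 0) :=
  localRellich_of_heat heat_mollification_estimate (fun _ hG => heat_L2_continuity hG) g hg hI2 hID hZ hD

end SeqCore

end NearSaturationNearMaximiser

end Summit.NavierStokesRegularity.NavierStokesRegularity.Theorems

end
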